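import Summits.QuantumFields.YangMills.Theorems.UnitScaleTiltHalvingHT4TGammaOfRawSocketsGamma
import Summits.QuantumFields.YangMills.Theorems.UnitScaleTiltHalvingHSiteRawP5BaseGammaOfLeaf
import Summits.QuantumFields.YangMills.Theorems.UnitScaleTiltHalvingHSiteRawP5GammaOfLeaf
import Summits.QuantumFields.YangMills.Theorems.UnitScaleTiltHalvingHSiteT4OfLeafSockets
import HarnessLib

/-!
# `hP1room` PROGRAMME — EDITION γ, v9 «hT4TLγ-REDUCE-γ + SLetτ-DISCHARGE» (LEAD-H ★w5-19200 g7 WORDS 12∕14∕15), FILE (3b):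
# ★★★ THE GUARDED THEOREM-4 SOCKET WITH SUPPORT CLAUSE `hT4Tγ` FROM THE TWO LEAF SOCKETS — the [4] LETTERS AT EVERY TRUNCATION and THEOREM 4's OWN (1.59) CLAUSE
# PER DATUM AT EVERY TRUNCATION — both THEOREMS on print's sub-lattice (✓p689656, ✓p690317); the γ twin of ✓`HalvingHSiteT4OfLeafSockets.hT4T_of_leafSockets`

Route `UnitScaleTilt`, crux K1 child «MinimiserStabilityRegPr» (stmt-QuantumFields-19200), registered stub `stub_halvingStep` (`BirthV10`).  Cell `ym3-torus` (HUMAN RULING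
D-0037: YM₃ on T³ is ladder rung R3 — NOT d = 4, NOT a mass gap, NOT the Clay problem), width seat `ym3-torus-px9` gen 5 (LEAD-H WORD 15 «v9 (3) LEAF FILES → px9 g5»).
`--supports stmt-QuantumFields-19200 --as helper`; THEOREMS ONLY (0 `def`, 0 `sorry`); count-neutral; nothing here claims `hT4TLγ`'s pack, `hSupUρ5`, the stub, the crux or the gap.

WHAT.  ★★★ `hT4Tγ_of_leafSocketsγ` — CONCLUSION = px3 g4's ✓`HalvingHT4TGammaOfRawSocketsGamma.hT4Tγ_of_rawSocketsγ` (p689943) conclusion VERBATIM (= ✓`siteDatum_of_T4Tγ`'s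
socket `hT4Tγ`: ∀ `gJ` under J3's four guards, ∀ `m ≤ K − n`: `u` `SU(2)`-valued, `u = 1` off `□₀`, (1.29), `W^{u} = U′`, Landau (1.38), chart at size `c⋆`); HYPOTHESES = p689943's
member ∕ constant ∕ γ-driver-window binders VERBATIM (`B₀ > 0`, `α₄ := 8B₀′c⋆` pinned, `B₀′ > 0`), the Prop-5 join's own γ windows (`h16γJ hsmallγJ hc₃γJ h61γJ`, `hBd`) and — in place
of the three raw sockets — the TWO LEAF SOCKETS: `SLetτAll` (the [4] letters + `τ`-laws at every truncation, ✓`hT4T_of_leafSockets`' binder VERBATIM) and `H59Dc` (Theorem 4's own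
two-member (1.59) clause per datum at every truncation and every chart radius `0 ≤ c ≤ 1∕2`, ✓`H59D_allLevels_flat_member5`'s per-datum text), plus the JOIN's window conjunction
`hwin` VERBATIM.  PROOF = p689943 with its raw sockets SERVED: `hP5baseγ` by FILE (3a′) ✓`rawP5baseγ_of_lettersτ_cubeMember`, `hP5γ` by FILE (3a) ✓`rawP5γ_of_lettersτ_cubeMember`
(both at `M₂(ℂ)`, `τ := tr`, `SU(2) ≤ SL(2, ℂ)` by lit ✓`B8SpecialLinearTrace` ∕ ✓`B8SpecialUnitaryTrace`, `U′ ∈ SU(2)` by ✓`pull_unitsField_toUField_mem_SU`, the tower row's `< s`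
feeding `< α₁` by `s ≤ α₁`, `H59D` at `c := c⋆`), `H59γ` by `H59Dc` at `c := 2(L·c⋆) + 8α₄` (`≤ 1∕2` by `h16`).  AFTER THIS FILE the STEP socket `hT4TLγ` of the K-final is
reducible, per member, to the two leaf sockets — which ✓p689656 and ✓p690317 discharge on print's sub-lattice (LEAD-H WORD 14: v9 display = `⟨H42topCrossT⟩` only).
HONEST SCOPE.  By-name plumbing; nothing of [4], Prop. 3 ∕ 5, Theorem 4, the pack, the stub or the crux is proved here.  Rung R3 (YM₃ on T³), NOT Clay; YM gap NOT proved.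

References: T. Bałaban, CMP **99** (1985) 75–102 [Balaban1985RegularSpaces] (Thm 4 p.88, Prop. 5 (1.106)–(1.109) p.94, (1.29) p.81, (1.31) p.82, (1.34)–(1.36) p.82, (1.58)–(1.59)
p.86, (1.66) p.87, p.98, p.76 («G = SU(N)»)); CMP **99** (1985) 389–434 [Balaban1985BackgroundPropagators] (Thm 3.1 p.397, (3.25) p.394, Thm 3.3 p.398); CMP **98** (1985) 17–51
[Balaban1985Averaging] ((42)–(43) pp.23–24).
-/

set_option autoImplicit false

noncomputable section

open scoped BigOperators Matrix.Norms.L2Operator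
open NormedSpace
open Complex (I)

namespace Summit.QuantumFields.YangMills.Theorems.HalvingHT4TGammaOfLeafSocketsGamma

open Literature.MathematicalPhysics.QuantumFieldTheory.Balaban1983to89
open Literature.MathematicalPhysics.QuantumFieldTheory.Balaban1983to89.T3ContinuumYM3Torus
open MatrixLog (mlog)
open B5Eq118OneStroke (iterBlockOf)
open B7Prop1Explicit (e expUnit)
open B7Prop1Explicit renaming Site → LSite
open B7Prop2Explicit (unitaryUnits C0 c2' avgIter)
open B7Prop2SpecialUnitary (specialUnitaryUnits mem_specialUnitaryUnits specialUnitaryUnits_le_unitaryUnits)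
open B7Prop3Flat (c3)
open B7Prop10General (C6 C4G)
open B7Prop9Flat (C5')
open B7Prop1Local (InBox)
open B7Eq78Linearization (conjR zdBlocking QprimeIter)
open B7Eq92Concrete (mgauge)
open B8Ineq130 (tlo thi)
open B8Ineq132 (covDerivFwd InAk BondTouches)
open B8Eq119TwistedAxial (Restr129 InAx bgT)
open B8Eq131Cubes (tLo tHi)
open B8Eq131CubesAdmissible (cubeFam)
open B8CubeMemberZd (cubeLamS cubeLamB)
open B8Eq184Proof (gaugeExp cfgExp)
open B8Eq140Level (SideTouches)
open B8Eq146AExpansion (iEta)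
open B8Eq138LandauZd (IsLandau138W covLap QT)
open B7Prop4GeneralLevels (logCovIter linCovIter)
open B8Eq155JBound (Jcur wsup)
open B8ScaledSupNorm (bondNorm msup)
open B8Ineq125Concrete (C2p)
open B8Eq1117Concrete (XSpace)
open B8Prop5ContractionKLevel (Bd2 Mc Kc)
open B8LambdaSpaceKLevel (wt)
open B9SupplySockB9P3ZdBeta (CrossB)
open B9SupplySockB9P3ZdGamma (cubeLamBP')
open B8SpecialUnitaryTrace (trCLM trCLM_mul_comm gaugeExp_mem_specialUnitaryUnits)
open B8SpecialLinearTrace (specialUnitaryUnits_le_slUnits trCLM_mlog_eq_zero_of_mem_slUnits expUnit_mem_slUnits avgClosed_specialUnitary)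
open B13Inv214OrbitSUN (slUnits)
open B10Eq27TorusAxialLog (pull pull_apply unitsField toUField unitsField_mem_unitaryUnits)
open HalvingP1FlatCoreSupplierDatumTrace (pull_unitsField_toUField_mem_SU)
open HalvingHT4TGammaOfRawSocketsGamma (hT4Tγ_of_rawSocketsγ)
open HalvingHSiteRawP5BaseGammaOfLeaf (rawP5baseγ_of_lettersτ_cubeMember)
open HalvingHSiteRawP5GammaOfLeaf (rawP5γ_of_lettersτ_cubeMember)

variable (F : T3Family) {n K : ℕ}

set_option maxHeartbeats 400000 in
/-- ★★★ **THE GUARDED THEOREM-4 SOCKET WITH SUPPORT CLAUSE `hT4Tγ` FROM THE TWO LEAF SOCKETS** (the [4] letters at every truncation + Theorem 4's own (1.59) clause per datum at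
every truncation — both theorems on print's sub-lattice) — conclusion = ✓`hT4Tγ_of_rawSocketsγ`'s VERBATIM; via ✓`hT4Tγ_of_rawSocketsγ` with its raw Prop.-5 sockets SERVED by
FILES (3a′)∕(3a) at `M₂(ℂ)`, `tr`, `SU(2) ≤ SL(2, ℂ)` and its (1.59) socket read off `H59Dc`; see the module docstring.
[cite: Balaban1985RegularSpaces, Thm 4 p.88, Prop. 5 (1.106)-(1.109) p.94, (1.59) p.86, (1.66) p.87, p.76, p.98; Balaban1985BackgroundPropagators, Thm 3.1 p.397, (3.25) p.394, Thm 3.3 p.398] -/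
theorem hT4Tγ_of_leafSocketsγ (L : ℕ) (hF : F.L = L) (hk1 : 1 ≤ K - n) (ρ S M M' : ℕ) {ρ' : ℕ} (hρ'def : ρ' = ρ + M + L + S)
    {ε₀ : ℝ} (hε₀ : 0 < ε₀) {s : ℝ} (hs0 : 0 ≤ s) (U : GaugeField (F.P K) 0 (Matrix.specialUnitaryGroup (Fin 2) ℂ)) (x₀ : Site (F.P K) 0)
    {t : ℤ} {a : LSite (F.P K).d} (hadef : a = fun μ => ((iterBlockOf (K - n) x₀ μ).val : ℤ) - t)
    -- Theorem 4's constants and the EDITION-γ windows (lit driver's binders VERBATIM at `d := (F.P K).d`, `L := (F.P K).L`, `α₀ := ε₀`, `a := s`)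
    {α₁ α₄ B₀ B₀' cstar C₂ Bbd : ℝ} (hα₁ : 0 < α₁) (hB₀ : 0 < B₀) (hB₀' : 0 < B₀')
    (hα₄def : α₄ = 8 * B₀' * (5 * ((F.P K).d : ℝ) * (F.P K).L * B₀) * (ε₀ + α₁)) (hsα₁ : s ≤ α₁) (hsmall₁ : ((F.P K).d : ℝ) * (F.P K).L * α₁ ≤ 1 / 8)
    (hc : cstar = 5 * (F.P K).d * (F.P K).L * B₀ * (ε₀ + α₁))
    (hs₁ : α₄ ≤ 1 / 84) (hs₂ : (F.P K).L * cstar ≤ 1 / 12) (hsa4 : s ≤ 1 / 4) (hs2c : 2 * s ≤ cstar)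
    (hα3 : C0 (F.P K).d * (((F.P K).L : ℝ) ^ 2 * ε₀) ≤ 1 / 3) (hα4 : 4 * (((F.P K).L : ℝ) ^ 2 * ε₀) ≤ c2' (F.P K).d (F.P K).L)
    (h16γ : 16 * (((F.P K).L : ℝ) * (2 * ((F.P K).L * cstar) + 8 * α₄)) ≤ 1)
    (h16 : 16 * (2 * ((F.P K).L * cstar) + 8 * α₄) ≤ 1) (hd5 : 5 * (2 * ((F.P K).L * cstar) + 8 * α₄) * (((F.P K).d : ℝ) - 1) ≤ 4)
    (hsmall : Real.exp (4 * (800 * (((F.P K).d : ℝ) + 1) ^ 2 * (((F.P K).d : ℝ) + 4)) * (((F.P K).L : ℝ) ^ 2 * ε₀))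
      * (1 + 8 * (131072 * (((F.P K).d : ℝ) + 1) ^ 2) * (((F.P K).L : ℝ) * (2 * ((F.P K).L * cstar) + 8 * α₄))) ≤ 2)
    (hc₃ : 2 * (((F.P K).L : ℝ) * (2 * ((F.P K).L * cstar) + 8 * α₄)) ≤ c3 (F.P K).d (F.P K).L)
    (hside : 36 * (F.P K).d * B₀ * (2 * ((F.P K).L * cstar) + 8 * α₄) ≤ 1 / 2)
    (h50 : 50 * (F.P K).d * (2 * ((F.P K).L * cstar) + 8 * α₄) ≤ 1)
    (hBbd : 0 ≤ Bbd) (hbdry : 4 * Bbd * s ≤ (((F.P K).d : ℝ) * (F.P K).L - 1) * B₀ * (ε₀ + α₁))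
    (hC₂ : 8 * (131072 * (((F.P K).d : ℝ) + 1) ^ 2) * Real.exp (4 * (800 * (((F.P K).d : ℝ) + 1) ^ 2 * (((F.P K).d : ℝ) + 4)) * (((F.P K).L : ℝ) ^ 2 * ε₀))
      * ((F.P K).L : ℝ) ^ 2 ≤ C₂)
    (h61 : 2 * (2 * ((F.P K).L * cstar) + 8 * α₄) ^ 2 + 20 * (F.P K).d * ε₀ * (2 * ((F.P K).L * cstar) + 8 * α₄)
      + 2 * C₂ * (2 * ((F.P K).L * cstar) + 8 * α₄) ^ 2 ≤ ε₀ + α₁)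
    -- EDITION γ, the Prop-5 JOIN's own windows: [3] Prop. 4 one level lower at `(L²ε₀, L·c⋆)`, its (1.61) window, the collar absorption `4B_∂ ≤ (dL − 1)B₀` (packs: ✓`gammaWindows_of_hw`, `hBdP`)
    (h16γJ : 16 * (((F.P K).L : ℝ) * cstar) ≤ 1)
    (hsmallγJ : Real.exp (4 * (800 * (((F.P K).d : ℝ) + 1) ^ 2 * (((F.P K).d : ℝ) + 4)) * (((F.P K).L : ℝ) ^ 2 * ε₀))
      * (1 + 8 * (131072 * (((F.P K).d : ℝ) + 1) ^ 2) * (((F.P K).L : ℝ) * cstar)) ≤ 2)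
    (hc₃γJ : 2 * (((F.P K).L : ℝ) * cstar) ≤ c3 (F.P K).d (F.P K).L)
    (h61γJ : 2 * cstar ^ 2 + 20 * (F.P K).d * ε₀ * cstar + 2 * C₂ * cstar ^ 2 ≤ ε₀ + α₁)
    (hBd : 4 * Bbd ≤ (((F.P K).d : ℝ) * (F.P K).L - 1) * B₀)
    -- THE LEAF SOCKET «[4] letters»: lit `SockLettersRD`'s body at `(ε₀, U₀ := 1, n′)` + the three `τ := tr` rows AT EVERY TRUNCATION `n′ ≤ K − n` on the member's cube families —
    -- ✓`HalvingHSiteT4OfLeafSockets.hT4T_of_leafSockets`' binder VERBATIM; a THEOREM on print's sub-lattice: ✓`HalvingSLetTauFlatCubeMember.SLetτAllL_holds_member` (p689656)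
    {B₀'H B₂' BG BR : ℝ} (hB₀'H : 0 < B₀'H) (hB₂' : 0 ≤ B₂') (hBG : 0 ≤ BG) (hBR : 0 ≤ BR)
    (SLetτAll : ∀ n', 1 ≤ n' → n' ≤ K - n →
      ∃ (g Δ : (LSite (F.P K).d → Matrix (Fin 2) (Fin 2) ℂ) →ₗ[ℂ] (LSite (F.P K).d → Matrix (Fin 2) (Fin 2) ℂ))
        (q : (LSite (F.P K).d → Matrix (Fin 2) (Fin 2) ℂ) →ₗ[ℂ] (ℕ → LSite (F.P K).d → Matrix (Fin 2) (Fin 2) ℂ))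
        (qs : (ℕ → LSite (F.P K).d → Matrix (Fin 2) (Fin 2) ℂ) →ₗ[ℂ] (LSite (F.P K).d → Matrix (Fin 2) (Fin 2) ℂ))
        (Aw c : (ℕ → LSite (F.P K).d → Matrix (Fin 2) (Fin 2) ℂ) →ₗ[ℂ] (ℕ → LSite (F.P K).d → Matrix (Fin 2) (Fin 2) ℂ))
        (H' : XSpace (F.P K).d n' (Matrix (Fin 2) (Fin 2) ℂ) →ₗ[ℂ] (LSite (F.P K).d → Matrix (Fin 2) (Fin 2) ℂ)),
      (∀ x, ∀ y ∈ cubeFam false (F.P K).L a M' ρ' (K - n) 0, (Δ (g x) + qs (Aw (q (g x)))) y = x y) ∧ (∀ f, q (g (g (qs (c (q f))))) = q f) ∧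
      (∀ (f : LSite (F.P K).d → Matrix (Fin 2) (Fin 2) ℂ), ∀ x ∈ cubeFam false (F.P K).L a M' ρ' (K - n) 0,
        Δ f x = covLap (((F.L : ℝ)⁻¹) ^ (K - n)) (1 : LSite (F.P K).d → Fin (F.P K).d → (Matrix (Fin 2) (Fin 2) ℂ)ˣ) ((cubeFam false (F.P K).L a M' ρ' (K - n) 0).indicator f) x) ∧
      (∀ (μ : ℕ → LSite (F.P K).d → Matrix (Fin 2) (Fin 2) ℂ), ∀ x ∈ cubeFam false (F.P K).L a M' ρ' (K - n) 0,
        qs μ x = QT (F.P K).L n' (cubeLamS (F.P K).L a M' ρ' (K - n) n') (1 : LSite (F.P K).d → Fin (F.P K).d → (Matrix (Fin 2) (Fin 2) ℂ)ˣ) μ x) ∧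
      (∀ (f : LSite (F.P K).d → Matrix (Fin 2) (Fin 2) ℂ) (j : ℕ), j ≤ n' → ∀ y ∈ cubeLamS (F.P K).L a M' ρ' (K - n) n' j,
        q f j y = QprimeIter (zdBlocking (F.P K).d (F.P K).L) (bgT (F.P K).L (1 : LSite (F.P K).d → Fin (F.P K).d → (Matrix (Fin 2) (Fin 2) ℂ)ˣ)) j f y) ∧
      (∀ (X : XSpace (F.P K).d n' (Matrix (Fin 2) (Fin 2) ℂ)) (x : LSite (F.P K).d), ‖H' X x‖ ≤ B₀'H * ‖X‖) ∧
      (∀ j, j ≤ n' → ∀ (X : XSpace (F.P K).d n' (Matrix (Fin 2) (Fin 2) ℂ)), ∀ p ∈ {b : LSite (F.P K).d × Fin (F.P K).d | SideTouches (cubeFam false (F.P K).L a M' ρ' (K - n) j) b.1 b.2},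
        wt (F.P K).L (((F.L : ℝ)⁻¹) ^ (K - n)) j * ‖covDerivFwd (((F.L : ℝ)⁻¹) ^ (K - n)) (1 : LSite (F.P K).d → Fin (F.P K).d → (Matrix (Fin 2) (Fin 2) ℂ)ˣ) p.2 (H' X) p.1‖ ≤ B₀'H * ‖X‖) ∧
      (∀ X : XSpace (F.P K).d n' (Matrix (Fin 2) (Fin 2) ℂ), Bd2 (F.P K).L (((F.L : ℝ)⁻¹) ^ (K - n)) n' (cubeFam false (F.P K).L a M' ρ' (K - n))
        (covLap (((F.L : ℝ)⁻¹) ^ (K - n)) (1 : LSite (F.P K).d → Fin (F.P K).d → (Matrix (Fin 2) (Fin 2) ℂ)ˣ) (H' X)) (B₂' * ‖X‖)) ∧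
      (∀ (X : XSpace (F.P K).d n' (Matrix (Fin 2) (Fin 2) ℂ)) (x : LSite (F.P K).d), x ∉ cubeFam false (F.P K).L a M' ρ' (K - n) 0 → H' X x = 0) ∧
      (∀ X Y : XSpace (F.P K).d n' (Matrix (Fin 2) (Fin 2) ℂ), (∀ p, Y p = -star (X p)) → ∀ x, H' Y x = -star (H' X x)) ∧
      (∀ (Y : XSpace (F.P K).d n' (Matrix (Fin 2) (Fin 2) ℂ)) (j : ℕ) (hj : j ≤ n') (y : LSite (F.P K).d), y ∈ cubeLamS (F.P K).L a M' ρ' (K - n) n' j →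
        QprimeIter (zdBlocking (F.P K).d (F.P K).L) (bgT (F.P K).L (1 : LSite (F.P K).d → Fin (F.P K).d → (Matrix (Fin 2) (Fin 2) ℂ)ˣ)) j (H' Y) y = Y (⟨j, Nat.lt_succ_of_le hj⟩, y)) ∧
      (∀ (f : LSite (F.P K).d → Matrix (Fin 2) (Fin 2) ℂ) (r : ℝ), 0 ≤ r → Bd2 (F.P K).L (((F.L : ℝ)⁻¹) ^ (K - n)) n' (cubeFam false (F.P K).L a M' ρ' (K - n)) f r →
        (∀ x, ‖g f x‖ ≤ BG * r) ∧ ∀ j, j ≤ n' → ∀ p ∈ {b : LSite (F.P K).d × Fin (F.P K).d | SideTouches (cubeFam false (F.P K).L a M' ρ' (K - n) j) b.1 b.2},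
          wt (F.P K).L (((F.L : ℝ)⁻¹) ^ (K - n)) j * ‖covDerivFwd (((F.L : ℝ)⁻¹) ^ (K - n)) (1 : LSite (F.P K).d → Fin (F.P K).d → (Matrix (Fin 2) (Fin 2) ℂ)ˣ) p.2 (g f) p.1‖ ≤ BG * r) ∧
      (∀ (f : LSite (F.P K).d → Matrix (Fin 2) (Fin 2) ℂ) (x : LSite (F.P K).d), x ∉ cubeFam false (F.P K).L a M' ρ' (K - n) 0 → g f x = 0) ∧
      (∀ f : LSite (F.P K).d → Matrix (Fin 2) (Fin 2) ℂ, (∀ j, j ≤ n' → ∀ x ∈ cubeFam false (F.P K).L a M' ρ' (K - n) j, IsSelfAdjoint (f x)) → ∀ x, IsSelfAdjoint (g f x)) ∧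
      (∀ (f : LSite (F.P K).d → Matrix (Fin 2) (Fin 2) ℂ) (r : ℝ), 0 ≤ r → Bd2 (F.P K).L (((F.L : ℝ)⁻¹) ^ (K - n)) n' (cubeFam false (F.P K).L a M' ρ' (K - n)) f r →
        Bd2 (F.P K).L (((F.L : ℝ)⁻¹) ^ (K - n)) n' (cubeFam false (F.P K).L a M' ρ' (K - n)) (f - g (qs (c (q (g f))))) (BR * r)) ∧
      (∀ f : LSite (F.P K).d → Matrix (Fin 2) (Fin 2) ℂ, (∀ j, j ≤ n' → ∀ x ∈ cubeFam false (F.P K).L a M' ρ' (K - n) j, IsSelfAdjoint (f x)) →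
        ∀ j, j ≤ n' → ∀ x ∈ cubeFam false (F.P K).L a M' ρ' (K - n) j, IsSelfAdjoint ((f - g (qs (c (q (g f))))) x)) ∧
      (∀ X : XSpace (F.P K).d n' (Matrix (Fin 2) (Fin 2) ℂ), (∀ p, trCLM (Fin 2) (X p) = 0) → ∀ x, trCLM (Fin 2) (H' X x) = 0) ∧
      (∀ f : LSite (F.P K).d → Matrix (Fin 2) (Fin 2) ℂ, (∀ j, j ≤ n' → ∀ x ∈ cubeFam false (F.P K).L a M' ρ' (K - n) j, trCLM (Fin 2) (f x) = 0) → ∀ x, trCLM (Fin 2) (g f x) = 0) ∧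
      (∀ f : LSite (F.P K).d → Matrix (Fin 2) (Fin 2) ℂ, (∀ j, j ≤ n' → ∀ x ∈ cubeFam false (F.P K).L a M' ρ' (K - n) j, trCLM (Fin 2) (f x) = 0) →
        ∀ j, j ≤ n' → ∀ x ∈ cubeFam false (F.P K).L a M' ρ' (K - n) j, trCLM (Fin 2) ((f - g (qs (c (q (g f))))) x) = 0))
    -- THE JOIN's SCALAR WINDOWS at `(ε₀, α₁)` as ONE conjunction — ✓`hT4T_of_leafSockets`' `hwin` VERBATIM (= lit ✓`B8SockHFPWindows.hfpWindows_of_guard`'s conclusion at `d := 3`;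
    -- its two b9 letters `cB9` are unused in edition γ)
    {cB9 : ℝ}
    (hwin : ∀ cs α₄' cB cDA hE hE₂ lE lE₂ : ℝ, cs = 5 * ((F.P K).d : ℝ) * (F.P K).L * B₀ * (ε₀ + α₁) → α₄' = 8 * B₀' * (5 * ((F.P K).d : ℝ) * (F.P K).L * B₀) * (ε₀ + α₁) →
      cB = (F.P K).L * cs → cDA = 2 * ((F.P K).d : ℝ) * ((F.P K).L : ℝ) ^ 2 * cs →
      hE = B₀'H * (C2p (F.P K).d * (40 * (F.P K).d * cB + α₄') * α₄') → hE₂ = B₂' * (C2p (F.P K).d * (40 * (F.P K).d * cB + α₄') * α₄') →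
      lE = B₀'H * (4 * C2p (F.P K).d * (40 * (F.P K).d * cB + 2 * α₄')) → lE₂ = B₂' * (4 * C2p (F.P K).d * (40 * (F.P K).d * cB + 2 * α₄')) →
      36 * (F.P K).d * B₀ * cs ≤ 1 / 2 ∧
      8 * (131072 * (((F.P K).d : ℝ) + 1) ^ 2) * Real.exp (4 * (800 * (((F.P K).d : ℝ) + 1) ^ 2 * (((F.P K).d : ℝ) + 4)) * ε₀) ≤ 16 * (131072 * (((F.P K).d : ℝ) + 1) ^ 2) ∧
      2 * cs ^ 2 + 20 * (F.P K).d * ε₀ * cs + 2 * (16 * (131072 * (((F.P K).d : ℝ) + 1) ^ 2)) * cs ^ 2 ≤ ε₀ + α₁ ∧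
      ((F.P K).d : ℝ) * (F.P K).L * α₁ ≤ 1 / 8 ∧
      ε₀ ≤ cB9 ∧ cs ≤ cB9 ∧
      C0 (F.P K).d * ε₀ ≤ 1 / 3 ∧ 4 * ε₀ ≤ c2' (F.P K).d (F.P K).L ∧
      Real.exp (4 * (800 * (((F.P K).d : ℝ) + 1) ^ 2 * (((F.P K).d : ℝ) + 4)) * ε₀) * (1 + 8 * (131072 * (((F.P K).d : ℝ) + 1) ^ 2) * cB) ≤ 2 ∧
      2 * cB ≤ c3 (F.P K).d (F.P K).L ∧ 2048 * ((F.P K).d : ℝ) * cB ≤ 1 ∧ 40 * (F.P K).d * cB ≤ 1 / 200 ∧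
      200 * C6 (F.P K).d * (2 * α₄') ≤ 1 ∧ 12000 * (((F.P K).d : ℝ) + 1) * (F.P K).L * (2 * α₄') ≤ 1 ∧
      C4G (F.P K).d (F.P K).L * (ε₀ + 40 * (F.P K).d * cB + 4 * (2 * α₄')) ≤ 1 ∧
      1024 * (((F.P K).d : ℝ) + 1) * (((F.P K).d : ℝ) + 4) * (F.P K).L ^ 2 * ε₀ ≤ 1 ∧ 32 * (((F.P K).d : ℝ) + 1) ^ 2 * C6 (F.P K).d * (F.P K).L ^ 2 * ε₀ ≤ 1 ∧
      16 * (F.P K).d * C5' (F.P K).d * C6 (F.P K).d * ((F.P K).L : ℝ) ^ 2 * ε₀ ≤ 1 ∧ 8 * (F.P K).d * C6 (F.P K).d * (F.P K).L * ε₀ ≤ 1 ∧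
      40 * (F.P K).d * cB + α₄' ≤ 1 / (4 * B₀'H * (2 * C2p (F.P K).d)) ∧ 2 * C6 (F.P K).d * (40 * (F.P K).d * cB + 4 * α₄') ≤ 1 / 8 ∧
      cB ≤ 1 / 13 ∧ α₄' / 4 + hE ≤ 1 / 24 ∧ α₄' / 4 + hE ≤ 1 / 140 ∧ 10 * (α₄' / 4 + hE) * BR ≤ 1 / 2 ∧
      BG * Mc (F.P K).d BR (α₄' / 4 + hE) cB hE₂ cDA ≤ α₄' / 4 ∧
      BG * Kc (F.P K).d BR (α₄' / 4 + hE) cB hE₂ cDA lE₂ (1 + lE) (1 + lE) ≤ 1 / 2)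
    -- THE LEAF SOCKET «(1.59)»: Theorem 4's own two-member clause PER DATUM at the flat background, every truncation `1 ≤ m ≤ K − n`, every chart radius `0 ≤ c ≤ 1∕2`,
    -- class `cubeLamBP′ … (K − n) m` ∪ the level-0 crossing bonds, collar `B_∂` — ✓`HalvingH59GammaDischargeFlatAllLevels.H59D_allLevels_flat_member5`'s (px10 g3, p690317) per-datum
    -- text after `B₀ Bbd` ([4] Thm 3.3 at `U = 1`, a THEOREM on print's sub-lattice); read at `c := c⋆` by the Prop-5 step join and at `c := 2(L·c⋆) + 8α₄` by the γ driver
    (H59Dc : ∀ c : ℝ, 0 ≤ c → c ≤ 1 / 2 →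
    ∀ (m : ℕ), 1 ≤ m → m ≤ K - n →
    ∀ (W : LSite (F.P K).d → Fin (F.P K).d → (Matrix (Fin 2) (Fin 2) ℂ)ˣ) (A' : LSite (F.P K).d → Fin (F.P K).d → (Matrix (Fin 2) (Fin 2) ℂ)),
      IsLandau138W (F.P K).L m (((F.L : ℝ)⁻¹) ^ (K - n)) ((cubeFam false (F.P K).L a M' ρ' (K - n)) 0) (cubeLamS (F.P K).L a M' ρ' (K - n) m)
        (1 : LSite (F.P K).d → Fin (F.P K).d → (Matrix (Fin 2) (Fin 2) ℂ)ˣ) W →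
      (∀ j, j ≤ m → ∀ y τ, SideTouches ((cubeFam false (F.P K).L a M' ρ' (K - n)) j) y τ →
        W y τ = cfgExp (((F.L : ℝ)⁻¹) ^ (K - n)) A' y τ ∧ ‖A' y τ‖ ≤ c * (((F.P K).L : ℝ) ^ j * (((F.L : ℝ)⁻¹) ^ (K - n)))⁻¹) →
      (∀ y τ, (∀ j, j ≤ m → ¬ SideTouches ((cubeFam false (F.P K).L a M' ρ' (K - n)) j) y τ) → A' y τ = 0) →
      msup (F.P K).L (m) (((F.L : ℝ)⁻¹) ^ (K - n)) (-(1 : ℝ)) (fun j (b : LSite (F.P K).d × Fin (F.P K).d) => SideTouches ((cubeFam false (F.P K).L a M' ρ' (K - n)) j) b.1 b.2) (fun b => A' b.1 b.2)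
            ≤ B₀ * (bondNorm (F.P K).L (m) (((F.L : ℝ)⁻¹) ^ (K - n)) (-(3 : ℝ)) (cubeFam false (F.P K).L a M' ρ' (K - n)) (fun x μ => Jcur (((F.L : ℝ)⁻¹) ^ (K - n)) (1 : LSite (F.P K).d → Fin (F.P K).d → (Matrix (Fin 2) (Fin 2) ℂ)ˣ) A' μ x)
              + wsup 1 (fun p : {p : ℕ × (LSite (F.P K).d × Fin (F.P K).d) // p.1 ≤ m ∧ (p.2 ∈ (cubeLamBP' (F.P K).L a M' ρ' (K - n) m) p.1 ∨ (p.1 = 0 ∧ CrossB ((cubeFam false (F.P K).L a M' ρ' (K - n)) 0) p.2))} =>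
                  linCovIter (F.P K).L (1 : LSite (F.P K).d → Fin (F.P K).d → (Matrix (Fin 2) (Fin 2) ℂ)ˣ) (iEta (((F.L : ℝ)⁻¹) ^ (K - n)) A') p.1.1 p.1.2.1 p.1.2.2))
              + Bbd * msup (F.P K).L (m) (((F.L : ℝ)⁻¹) ^ (K - n)) (-(1 : ℝ)) (fun j (b : LSite (F.P K).d × Fin (F.P K).d) => j = 0 ∧ SideTouches ((cubeFam false (F.P K).L a M' ρ' (K - n)) 0) b.1 b.2 ∧ ¬ BondTouches ((cubeFam false (F.P K).L a M' ρ' (K - n)) 0) b.1 b.2)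
                  (fun b => A' b.1 b.2) ∧
          msup (F.P K).L (m) (((F.L : ℝ)⁻¹) ^ (K - n)) (-(2 : ℝ)) (fun j (t : Fin (F.P K).d × Fin (F.P K).d × LSite (F.P K).d) => SideTouches ((cubeFam false (F.P K).L a M' ρ' (K - n)) j) t.2.2 t.2.1)
              (fun t => covDerivFwd (((F.L : ℝ)⁻¹) ^ (K - n)) (1 : LSite (F.P K).d → Fin (F.P K).d → (Matrix (Fin 2) (Fin 2) ℂ)ˣ) t.1 (fun z => A' z t.2.1) t.2.2)
            ≤ B₀ * (bondNorm (F.P K).L (m) (((F.L : ℝ)⁻¹) ^ (K - n)) (-(3 : ℝ)) (cubeFam false (F.P K).L a M' ρ' (K - n)) (fun x μ => Jcur (((F.L : ℝ)⁻¹) ^ (K - n)) (1 : LSite (F.P K).d → Fin (F.P K).d → (Matrix (Fin 2) (Fin 2) ℂ)ˣ) A' μ x)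
              + wsup 1 (fun p : {p : ℕ × (LSite (F.P K).d × Fin (F.P K).d) // p.1 ≤ m ∧ (p.2 ∈ (cubeLamBP' (F.P K).L a M' ρ' (K - n) m) p.1 ∨ (p.1 = 0 ∧ CrossB ((cubeFam false (F.P K).L a M' ρ' (K - n)) 0) p.2))} =>
                  linCovIter (F.P K).L (1 : LSite (F.P K).d → Fin (F.P K).d → (Matrix (Fin 2) (Fin 2) ℂ)ˣ) (iEta (((F.L : ℝ)⁻¹) ^ (K - n)) A') p.1.1 p.1.2.1 p.1.2.2))
              + Bbd * msup (F.P K).L (m) (((F.L : ℝ)⁻¹) ^ (K - n)) (-(1 : ℝ)) (fun j (b : LSite (F.P K).d × Fin (F.P K).d) => j = 0 ∧ SideTouches ((cubeFam false (F.P K).L a M' ρ' (K - n)) 0) b.1 b.2 ∧ ¬ BondTouches ((cubeFam false (F.P K).L a M' ρ' (K - n)) 0) b.1 b.2)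
                  (fun b => A' b.1 b.2)) :
    -- CONCLUSION = `siteDatum_of_T4Tγ`'s socket `hT4Tγ` VERBATIM
    ∀ gJ : GaugeTransf (F.P K) 0 (Matrix.specialUnitaryGroup (Fin 2) ℂ),
      InAk (F.P K).L (K - n) (((F.L : ℝ)⁻¹) ^ (K - n)) ε₀ (fun _ => (Set.univ : Set (LSite (F.P K).d))) (pull (unitsField (toUField (GaugeField.gaugeAct gJ U))) 0) →
      (∀ m', m' ≤ K - n → ∀ Λ : ℕ → Set (LSite (F.P K).d),
        InAx (F.P K).L m' Λ (1 : LSite (F.P K).d → Fin (F.P K).d → (Matrix (Fin 2) (Fin 2) ℂ)ˣ) (pull (unitsField (toUField (GaugeField.gaugeAct gJ U))) 0)) →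
      (∀ m', m' ≤ K - n → ∀ (x : LSite (F.P K).d) (ν : Fin (F.P K).d), tlo (F.P K).L (tLo a ρ') m' ≤ x → x + e ν ≤ thi (F.P K).L (tHi a M' ρ') m' →
        ‖((avgIter (F.P K).L (pull (unitsField (toUField (GaugeField.gaugeAct gJ U))) 0) (K - n - m') x ν : (Matrix (Fin 2) (Fin 2) ℂ)ˣ) :
            Matrix (Fin 2) (Fin 2) ℂ) - 1‖ < s) →
      (∀ (x : LSite (F.P K).d) (ν : Fin (F.P K).d), tlo (F.P K).L (tLo a ρ') (K - n) ≤ x → x + e ν ≤ thi (F.P K).L (tHi a M' ρ') (K - n) →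
        ‖((pull (unitsField (toUField (GaugeField.gaugeAct gJ U))) 0 x ν : (Matrix (Fin 2) (Fin 2) ℂ)ˣ) : Matrix (Fin 2) (Fin 2) ℂ) - 1‖ < s) →
      ∀ m, m ≤ K - n → ∃ u : LSite (F.P K).d → (Matrix (Fin 2) (Fin 2) ℂ)ˣ,
        (∀ x, ((u x : (Matrix (Fin 2) (Fin 2) ℂ)ˣ) : Matrix (Fin 2) (Fin 2) ℂ) ∈ Matrix.specialUnitaryGroup (Fin 2) ℂ) ∧
        (∀ x, x ∉ cubeFam false (F.P K).L a M' ρ' (K - n) 0 → u x = 1) ∧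
        Restr129 (F.P K).L m (cubeLamS (F.P K).L a M' ρ' (K - n) m) (1 : LSite (F.P K).d → Fin (F.P K).d → (Matrix (Fin 2) (Fin 2) ℂ)ˣ) u ∧
        ∃ W : LSite (F.P K).d → Fin (F.P K).d → (Matrix (Fin 2) (Fin 2) ℂ)ˣ,
          mgauge (1 : LSite (F.P K).d → Fin (F.P K).d → (Matrix (Fin 2) (Fin 2) ℂ)ˣ) u W = pull (unitsField (toUField (GaugeField.gaugeAct gJ U))) 0 ∧
          (1 ≤ m → IsLandau138W (F.P K).L m (((F.L : ℝ)⁻¹) ^ (K - n)) (cubeFam false (F.P K).L a M' ρ' (K - n) 0) (cubeLamS (F.P K).L a M' ρ' (K - n) m)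
            (1 : LSite (F.P K).d → Fin (F.P K).d → (Matrix (Fin 2) (Fin 2) ℂ)ˣ) W) ∧
          ∃ A : LSite (F.P K).d → Fin (F.P K).d → Matrix (Fin 2) (Fin 2) ℂ, ∀ j, j ≤ m →
            ∀ b ∈ {b : LSite (F.P K).d × Fin (F.P K).d | SideTouches (cubeFam false (F.P K).L a M' ρ' (K - n) j) b.1 b.2},
              W b.1 b.2 = cfgExp (((F.L : ℝ)⁻¹) ^ (K - n)) A b.1 b.2 ∧ IsSelfAdjoint (A b.1 b.2) ∧
                ‖A b.1 b.2‖ ≤ cstar * (((F.P K).L : ℝ) ^ j * ((F.L : ℝ)⁻¹) ^ (K - n))⁻¹ := by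
  letI : CStarAlgebra (Matrix (Fin 2) (Fin 2) ℂ) := B10Eq29TubeLine.cstarAlgebraMatrix 2
  subst hc
  have hd2 : 2 ≤ (F.P K).d := by rw [T3Family.P_d F K]; norm_num
  have hL2 : 2 ≤ (F.P K).L := (F.P K).hL.2
  have hL1 : 1 ≤ (F.P K).L := (F.P K).L_pos
  have hLr : (1 : ℝ) ≤ (F.P K).L := by exact_mod_cast hL1
  have hη : 0 < ((F.L : ℝ)⁻¹) ^ (K - n) := by
    have hL0 : (0 : ℝ) < F.L := by exact_mod_cast (F.P K).L_pos
    positivity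
  have hρL : (F.P K).L ≤ ρ' := by
    have hLF : (F.P K).L = F.L := rfl
    rw [hLF, hF, hρ'def]; omega
  have hsum : 0 ≤ ε₀ + α₁ := by linarith
  have hα₄0 : 0 ≤ α₄ := by rw [hα₄def]; positivity
  have hcs0 : 0 ≤ 5 * ((F.P K).d : ℝ) * (F.P K).L * B₀ * (ε₀ + α₁) := by positivity
  have hcs_half : 5 * ((F.P K).d : ℝ) * (F.P K).L * B₀ * (ε₀ + α₁) ≤ 1 / 2 := by
    have h1 : 5 * ((F.P K).d : ℝ) * (F.P K).L * B₀ * (ε₀ + α₁) ≤ (F.P K).L * (5 * ((F.P K).d : ℝ) * (F.P K).L * B₀ * (ε₀ + α₁)) :=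
      le_mul_of_one_le_left hcs0 hLr
    linarith
  have hrad0 : 0 ≤ 2 * ((F.P K).L * (5 * ((F.P K).d : ℝ) * (F.P K).L * B₀ * (ε₀ + α₁))) + 8 * α₄ := by positivity
  have hrad_half : 2 * ((F.P K).L * (5 * ((F.P K).d : ℝ) * (F.P K).L * B₀ * (ε₀ + α₁))) + 8 * α₄ ≤ 1 / 2 := by linarith
  -- (G3) for `SU(2)`: Hermitian trace-free `λ` exponentiates into `SU(2)`
  have hG3 : ∀ lam : LSite (F.P K).d → Matrix (Fin 2) (Fin 2) ℂ, (∀ x, IsSelfAdjoint (lam x)) → (∀ x, trCLM (Fin 2) (lam x) = 0) →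
      ∀ x, gaugeExp lam x ∈ specialUnitaryUnits (Fin 2) := fun lam hsa htr x => gaugeExp_mem_specialUnitaryUnits hsa htr x
  refine hT4Tγ_of_rawSocketsγ F L hF hk1 ρ S M M' hρ'def hε₀ hs0 U x₀ hadef hα₁ hα₄0 hB₀.le hsα₁ hsmall₁ rfl hs₁ hs₂ hsa4 hs2c hα3 hα4 h16γ h16 hd5
    hsmall hc₃ hside h50 hBbd hbdry hC₂ h61 ?_ ?_ ?_
  · -- the raw BASE socket with support from the letters at truncation `1` (FILE (3a′))
    intro gJ' hInAk' hInAx' htw'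
    have hU'G' : ∀ (x : LSite (F.P K).d) (κ : Fin (F.P K).d),
        pull (unitsField (toUField (GaugeField.gaugeAct gJ' U))) 0 x κ ∈ specialUnitaryUnits (Fin 2) :=
      fun x κ => mem_specialUnitaryUnits.2 (pull_unitsField_toUField_mem_SU (GaugeField.gaugeAct gJ' U) 0 x κ)
    -- (1.66) at size `s` on the collar at depth `K − n` = the tower row (d) at `m′ := K − n` (`Ū⁰ = U′`); `2s ≤ c⋆` is Theorem 4's window `hs2c`
    have hfine' : ∀ (x : LSite (F.P K).d) (ν : Fin (F.P K).d), tlo (F.P K).L (tLo a ρ') (K - n) ≤ x → x + e ν ≤ thi (F.P K).L (tHi a M' ρ') (K - n) →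
        ‖((pull (unitsField (toUField (GaugeField.gaugeAct gJ' U))) 0 x ν : (Matrix (Fin 2) (Fin 2) ℂ)ˣ) : Matrix (Fin 2) (Fin 2) ℂ) - 1‖ < s := by
      intro x ν h1 h2
      have h := htw' (K - n) le_rfl x ν h1 h2
      rwa [Nat.sub_self, B7Prop2Explicit.avgIter_zero] at h
    have h := rawP5baseγ_of_lettersτ_cubeMember (𝔸 := Matrix (Fin 2) (Fin 2) ℂ) (trCLM (Fin 2)) (trCLM_mul_comm (n := Fin 2)) hd2 hL2 hη hk1
      (G := specialUnitaryUnits (Fin 2)) (H := slUnits 2)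
      (fun g hg hs => trCLM_mlog_eq_zero_of_mem_slUnits (by norm_num) hg hs) (fun S hS => expUnit_mem_slUnits hS)
      (avgClosed_specialUnitary (F.P K).d (F.P K).L (N := 2) (by norm_num)) specialUnitaryUnits_le_slUnits specialUnitaryUnits_le_unitaryUnits hG3
      a M' hρL rfl rfl hε₀ hα₁ hB₀ hB₀' hU'G' hInAk' hInAx' hs2c hfine' hB₀'H hB₂' hBG hBR SLetτAll hwin
    rw [hα₄def]
    exact h
  · -- the raw STEP socket with support from the letters at truncation `m + 1` and Theorem 4's (1.59) clause for the datum at level `m` (FILE (3a))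
    intro gJ' hInAk' hInAx' htw'
    have htwα' : ∀ m', m' ≤ K - n → ∀ (x : LSite (F.P K).d) (ν : Fin (F.P K).d), tlo (F.P K).L (tLo a ρ') m' ≤ x → x + e ν ≤ thi (F.P K).L (tHi a M' ρ') m' →
        ‖((avgIter (F.P K).L (pull (unitsField (toUField (GaugeField.gaugeAct gJ' U))) 0) (K - n - m') x ν : (Matrix (Fin 2) (Fin 2) ℂ)ˣ) :
            Matrix (Fin 2) (Fin 2) ℂ) - 1‖ < α₁ :=
      fun m' hm' x ν h1 h2 => lt_of_lt_of_le (htw' m' hm' x ν h1 h2) hsα₁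
    have hU'G' : ∀ (x : LSite (F.P K).d) (κ : Fin (F.P K).d),
        pull (unitsField (toUField (GaugeField.gaugeAct gJ' U))) 0 x κ ∈ specialUnitaryUnits (Fin 2) :=
      fun x κ => mem_specialUnitaryUnits.2 (pull_unitsField_toUField_mem_SU (GaugeField.gaugeAct gJ' U) 0 x κ)
    have h := rawP5γ_of_lettersτ_cubeMember (𝔸 := Matrix (Fin 2) (Fin 2) ℂ) (trCLM (Fin 2)) (trCLM_mul_comm (n := Fin 2)) hd2 hL2 hη (k := K - n)
      (G := specialUnitaryUnits (Fin 2)) (H := slUnits 2)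
      (fun g hg hs => trCLM_mlog_eq_zero_of_mem_slUnits (by norm_num) hg hs) (fun S hS => expUnit_mem_slUnits hS)
      (avgClosed_specialUnitary (F.P K).d (F.P K).L (N := 2) (by norm_num)) specialUnitaryUnits_le_slUnits specialUnitaryUnits_le_unitaryUnits hG3
      a M' hρL rfl rfl rfl hε₀ hα₁ hB₀ hB₀' hU'G' hInAk' hInAx' htwα' hBbd hBd
      (fun m hm1 hmk U₁ A' hLan hUA hA0 => H59Dc _ hcs0 hcs_half m hm1 hmk.le U₁ A' hLan hUA hA0)
      hα3 hα4 h16γJ hsmallγJ hc₃γJ hC₂ h61γJ hB₀'H hB₂' hBG hBR SLetτAll hwin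
    rw [hα₄def]
    exact h
  · -- the (1.59) socket of the γ driver at chart radius `2(L·c⋆) + 8α₄`, straight from the per-datum clause (the guards and the datum prefix are not needed)
    intro gJ' _ _ _ m hm1 hmk u W A' _ _ _ _ hLan _ hWA hA0
    exact H59Dc _ hrad0 hrad_half m hm1 hmk W A' hLan hWA hA0

end Summit.QuantumFields.YangMills.Theorems.HalvingHT4TGammaOfLeafSocketsGamma

end
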